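import Literature.NumberTheory.Automorphic.UnipotentConvAbsorption
import Literature.NumberTheory.Automorphic.KirillovDilationGL2
import Literature.Analysis.UnboundedOperators.UnitaryRepSpectralMoments
import Mathlib.Analysis.Calculus.ParametricIntegral
import Mathlib.MeasureTheory.Integral.IntervalIntegral.FundThmCalculus
import HarnessLib

/-!
# `L²`-differentiability of smoothed vectors along the archimedean unipotent line; difference bounds

Topic `NumberTheory/Automorphic`; namespace `Literature.NumberTheory.Automorphic`. Proof file
(theorems only). For a test function `θ` on `GL_2(𝔸_K)`, `f` in a closed subrepresentation
`W ≤ L²` and a direction `e ∈ K_∞`, the orbit of the smoothed vector `S_θ f` under the archimedean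
unipotent line `U_x = R(n((x,0)))` (`archUnipotentRep`) is

  `U_{se} S_θ f = S_{L_{n(se)} θ} f`   (`coe_smoothedVector_leftTranslate`).

We PROVE:

* `hasDerivAt_smoothedVector_archUnipotent_line` — **the orbit is differentiable in `L²`** with
  derivative `S_{L_{n(se)} θ_X} f`, `X = e E₁₂` (`θ_X = derivWeight`); differentiation under the
  Bochner integral `S_η f = ∫ η(g) R(g) f dg` with the domination `‖θ_X‖_∞ 𝟙_{compact} ‖f‖`, the
  pointwise derivative being `d/ds θ(n(se)⁻¹ g) = θ_X(n(se)⁻¹ g)`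
  (`derivWeight_smul_matE_apply_eq_fderiv`);
* `sub_eq_intervalIntegral_smoothedVector` — **FTC**: `U_{te} S_θ f - S_θ f = ∫₀ᵗ U_{se} S_{θ_X} f ds`;
* `norm_iterDiff_smoothedVector_le` — **difference bounds of every order**:
  `‖(U_{te} - 1)^N S_θ f‖ ≤ |t|^N ‖S_{θ_{X^N}} f‖`, `θ_{X^N} = wordDerivWeight [X, …, X] θ` — the
  hypothesis of `UnitaryRep.lintegral_pow_abs_bilin_le_of_norm_iterDiff_le` (moments of the spectral
  measure of `S_θ f`), i.e. the Sobolev control of the `N`-spectral measure of a Gårding vector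
  (Stone; Folland (1995), Thm. 4.44) in the Kirillov `L²`-bound (Jacquet–Shalika (1981), §4).

## References

* H. Jacquet, J. A. Shalika, *On Euler products and the classification of automorphic
  representations I*, Amer. J. Math. 103 (1981), §4 [JacquetShalikaAJM1981].
* G. B. Folland, *A course in abstract harmonic analysis* (1995), Thm. 4.44 [Folland1995].
* D. Bump, *Automorphic Forms and Representations* (1997), §2.2 (2.28)–(2.29) [Bump1997].
-/

noncomputable section

open scoped MatrixGroups Classical ContDiff Interval
open NumberField NumberField.mixedEmbedding IsDedekindDomain MeasureTheory Complex
open Literature.Analysis.UnboundedOperators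

namespace Literature.NumberTheory.Automorphic

variable {K : Type} [Field K] [NumberField K]
  (hcpt : isCompact_glFiniteIntegralLevel 2 K)
  {μ : Measure (AdelicGroupData.gl 2 K).automorphicQuotient} [(AdelicGroupData.gl 2 K).IsAutomorphicMeasure μ]

attribute [local instance] adelicBorel borelSpace_adelic locallyCompactSpace_adelic
  secondCountableTopology_gl_adelic

set_option backward.isDefEq.respectTransparency false

attribute [local instance 100] LieRing.ofAssociativeRing

open scoped Matrix.Norms.Operator

/-! ### The unipotent letter and its invariance under unipotent translates -/

/-- The unipotent letter `X_e = e E₁₂ ∈ 𝔤`. [folklore] -/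
abbrev unipotentLetter (e : mixedSpace K) : (AutomorphyDatum.gl 2 K hcpt).arch.lie :=
  toLie hcpt (e • (matE : Matrix (Fin 2) (Fin 2) (mixedSpace K)))

/-- `Ad(n(x)⁻¹) X_e = X_e` (`E₁₂² = 0`). [folklore] -/
theorem adInvLie_unipotentGL2_unipotentLetter (x e : mixedSpace K) :
    adInvLie hcpt ((unipotentGL2 x : ↥(upperUnitriangular (Fin 2) (mixedSpace K))) : GL (Fin 2) (mixedSpace K))
      (unipotentLetter hcpt e) = unipotentLetter hcpt e := by
  refine Subtype.ext ?_
  rw [coe_adInvLie_unipotentGL2]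
  show e • (matE : Matrix (Fin 2) (Fin 2) (mixedSpace K)) + x • adTerm₁ (e • (matE : Matrix (Fin 2) (Fin 2) (mixedSpace K))) +
    (x * x) • adTerm₂ (e • (matE : Matrix (Fin 2) (Fin 2) (mixedSpace K))) = e • matE
  simp only [adTerm₁, adTerm₂, smul_mul_assoc, mul_smul_comm, matE_mul_matE, smul_zero, sub_self, zero_mul, neg_zero, add_zero]

/-- **Unipotent derivatives commute with unipotent translates**: `(L_{n(x)} θ)_{X_e} = L_{n(x)} (θ_{X_e})`
for a test function `θ`. [folklore] -/
theorem derivWeight_unipotentLetter_leftTranslate_archUnipotent {θ : GL (Fin 2) (AdeleRing (𝓞 K) K) → ℝ}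
    (hθ : IsTestFunctionGL 2 K θ) (x e : mixedSpace K) :
    derivWeight (AutomorphyDatum.gl 2 K hcpt).ofArch (unipotentLetter hcpt e) (leftTranslateWeight (n := 2) (archUnipotentGL K x) θ) =
      leftTranslateWeight (n := 2) (archUnipotentGL K x) (derivWeight (AutomorphyDatum.gl 2 K hcpt).ofArch (unipotentLetter hcpt e) θ) := by
  rw [derivWeight_leftTranslateWeight hcpt hθ, toMixed_archUnipotentGL, adInvLie_unipotentGL2_unipotentLetter]

/-- Words of unipotent letters commute with unipotent translates. [folklore] -/
theorem wordDerivWeight_replicate_leftTranslate_archUnipotent {θ : GL (Fin 2) (AdeleRing (𝓞 K) K) → ℝ}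
    (hθ : IsTestFunctionGL 2 K θ) (x e : mixedSpace K) :
    ∀ N : ℕ, wordDerivWeight (AutomorphyDatum.gl 2 K hcpt).ofArch (List.replicate N (unipotentLetter hcpt e))
        (leftTranslateWeight (n := 2) (archUnipotentGL K x) θ) =
      leftTranslateWeight (n := 2) (archUnipotentGL K x)
        (wordDerivWeight (AutomorphyDatum.gl 2 K hcpt).ofArch (List.replicate N (unipotentLetter hcpt e)) θ)
  | 0 => rfl
  | N + 1 => by
    rw [List.replicate_succ, wordDerivWeight_cons, wordDerivWeight_cons,
      wordDerivWeight_replicate_leftTranslate_archUnipotent hθ x e N,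
      derivWeight_unipotentLetter_leftTranslate_archUnipotent hcpt (isTestFunctionGL_wordDerivWeight_rep hθ e N)]
where
  /-- (auxiliary) words of a test function are test functions -/
  isTestFunctionGL_wordDerivWeight_rep {θ : GL (Fin 2) (AdeleRing (𝓞 K) K) → ℝ} (hθ : IsTestFunctionGL 2 K θ) (e : mixedSpace K) :
      ∀ N : ℕ, IsTestFunctionGL 2 K (wordDerivWeight (AutomorphyDatum.gl 2 K hcpt).ofArch (List.replicate N (unipotentLetter hcpt e)) θ)
    | 0 => hθ
    | N + 1 => by
      rw [List.replicate_succ, wordDerivWeight_cons]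
      exact isTestFunctionGL_derivWeight hcpt (isTestFunctionGL_wordDerivWeight_rep hθ e N) _

/-- Appending a letter: `wordDerivWeight (w ++ [Y]) θ = wordDerivWeight w (θ_Y)`. [folklore] -/
theorem wordDerivWeight_append_singleton (Y : (AutomorphyDatum.gl 2 K hcpt).arch.lie) (θ : GL (Fin 2) (AdeleRing (𝓞 K) K) → ℝ) :
    ∀ w : List (AutomorphyDatum.gl 2 K hcpt).arch.lie,
      wordDerivWeight (AutomorphyDatum.gl 2 K hcpt).ofArch (w ++ [Y]) θ =
        wordDerivWeight (AutomorphyDatum.gl 2 K hcpt).ofArch w (derivWeight (AutomorphyDatum.gl 2 K hcpt).ofArch Y θ)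
  | [] => rfl
  | X :: w => by rw [List.cons_append, wordDerivWeight_cons, wordDerivWeight_cons, wordDerivWeight_append_singleton Y θ w]

/-! ### Differentiability of the orbit along the unipotent line -/

/-- **The pointwise derivative**: `d/ds θ(n(se)⁻¹ g) = θ_{X_e}(n(se)⁻¹ g)` for a test function `θ`.
[folklore] -/
theorem hasDerivAt_weight_archUnipotent_line {θ : GL (Fin 2) (AdeleRing (𝓞 K) K) → ℝ} (hθ : IsTestFunctionGL 2 K θ)
    (e : mixedSpace K) (g : GL (Fin 2) (AdeleRing (𝓞 K) K)) (s₀ : ℝ) :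
    HasDerivAt (fun s : ℝ => θ ((archUnipotentGL K (s • e))⁻¹ * g))
      (derivWeight (AutomorphyDatum.gl 2 K hcpt).ofArch (unipotentLetter hcpt e) θ ((archUnipotentGL K (s₀ • e))⁻¹ * g)) s₀ := by
  have hF : Differentiable ℝ fun z : mixedSpace K => θ ((archUnipotentGL K z)⁻¹ * g) :=
    (contDiff_theta_archUnipotent hθ g).differentiable (by simp)
  have hline : HasDerivAt (fun s : ℝ => s • e) e s₀ := by simpa using (hasDerivAt_id s₀).smul_const e
  have h := (hF (s₀ • e)).hasFDerivAt.comp_hasDerivAt s₀ hline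
  rw [← derivWeight_smul_matE_apply_eq_fderiv hcpt hθ e (s₀ • e) g] at h
  exact h

variable (W : ContRepresentation.ClosedSubrep ((AdelicGroupData.gl 2 K).rightRegular μ))

/-- The `L²`-valued integrand of a smoothed vector is integrable (continuous, compactly supported).
[folklore] -/
private theorem integrable_ofReal_smul_rightRegular₂ {η : (AdelicGroupData.gl 2 K).Adelic → ℝ} (hη : Continuous η)
    (hηs : HasCompactSupport η) (F : (AdelicGroupData.gl 2 K).L2 μ) :
    Integrable (fun g => (η g : ℂ) • (AdelicGroupData.gl 2 K).rightRegular μ g F) (adelicHaar 2 K) := by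
  refine Continuous.integrable_of_hasCompactSupport ?_ ?_
  · exact (continuous_ofReal.comp hη).smul ((AdelicGroupData.isStronglyContinuous_rightRegular_holds (AdelicGroupData.gl 2 K) μ) F)
  · exact (hηs.comp_left ofReal_zero).smul_right

/-- A test function is bounded. [folklore] -/
theorem IsTestFunctionGL.exists_forall_abs_le {η : GL (Fin 2) (AdeleRing (𝓞 K) K) → ℝ} (hη : IsTestFunctionGL 2 K η) :
    ∃ M : ℝ, 0 ≤ M ∧ ∀ g, |η g| ≤ M := by
  obtain ⟨M, hM⟩ := hη.continuous.bounded_above_of_compact_support hη.hasCompactSupport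
  exact ⟨max M 0, le_max_right _ _, fun g => (Real.norm_eq_abs _ ▸ hM g).trans (le_max_left _ _)⟩

/-- `GL_2(𝔸_K)` is Hausdorff (a private copy of `t2Space_gl` of `AdelicGroupDataGLnProofs`, which
is not imported here). [folklore] -/
private theorem t2Space_gl' : T2Space (GL (Fin 2) (AdeleRing (𝓞 K) K)) := by
  haveI : T2Space (FiniteAdeleRing (𝓞 K) K) := inferInstanceAs <| T2Space
    (RestrictedProduct (fun v : IsDedekindDomain.HeightOneSpectrum (𝓞 K) => v.adicCompletion K)
      (fun v => (v.adicCompletionIntegers K : Set (v.adicCompletion K))) Filter.cofinite)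
  haveI : T2Space (InfiniteAdeleRing K) :=
    inferInstanceAs <| T2Space ((w : InfinitePlace K) → w.Completion)
  haveI : T2Space (AdeleRing (𝓞 K) K) :=
    inferInstanceAs <| T2Space (InfiniteAdeleRing K × FiniteAdeleRing (𝓞 K) K)
  infer_instance

set_option maxHeartbeats 800000 in
/-- **The orbit of a smoothed vector along the unipotent line is differentiable in `L²`**:
`d/ds S_{L_{n(se)} θ} f = S_{L_{n(se)} θ_{X_e}} f`. [cite: JacquetShalikaAJM1981, §4] -/
theorem hasDerivAt_smoothedVector_archUnipotent_line {θ : GL (Fin 2) (AdeleRing (𝓞 K) K) → ℝ}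
    (hθ : IsTestFunctionGL 2 K θ) (e : mixedSpace K) (f : W.toSubmodule) (s₀ : ℝ) :
    HasDerivAt (fun s : ℝ => (smoothedVector W (leftTranslateWeight (n := 2) (archUnipotentAdelic K (s • e)) θ) f :
        (AdelicGroupData.gl 2 K).L2 μ))
      (smoothedVector W (leftTranslateWeight (n := 2) (archUnipotentAdelic K (s₀ • e))
        (derivWeight (AutomorphyDatum.gl 2 K hcpt).ofArch (unipotentLetter hcpt e) θ)) f : (AdelicGroupData.gl 2 K).L2 μ) s₀ := by
  haveI : T2Space (AdelicGroupData.gl 2 K).Adelic := t2Space_gl'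
  set θX := derivWeight (AutomorphyDatum.gl 2 K hcpt).ofArch (unipotentLetter hcpt e) θ with hθX
  have hθXt : IsTestFunctionGL 2 K θX := isTestFunctionGL_derivWeight hcpt hθ _
  -- the integrands
  set F : ℝ → (AdelicGroupData.gl 2 K).Adelic → (AdelicGroupData.gl 2 K).L2 μ := fun s g =>
    ((leftTranslateWeight (n := 2) (archUnipotentAdelic K (s • e)) θ g : ℝ) : ℂ) •
      (AdelicGroupData.gl 2 K).rightRegular μ g (f : (AdelicGroupData.gl 2 K).L2 μ) with hF
  set F' : ℝ → (AdelicGroupData.gl 2 K).Adelic → (AdelicGroupData.gl 2 K).L2 μ := fun s g =>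
    ((leftTranslateWeight (n := 2) (archUnipotentAdelic K (s • e)) θX g : ℝ) : ℂ) •
      (AdelicGroupData.gl 2 K).rightRegular μ g (f : (AdelicGroupData.gl 2 K).L2 μ) with hF'
  have hFeq : ∀ s, (smoothedVector W (leftTranslateWeight (n := 2) (archUnipotentAdelic K (s • e)) θ) f :
      (AdelicGroupData.gl 2 K).L2 μ) = ∫ g, F s g ∂(adelicHaar 2 K) := fun s =>
    coe_smoothedVector W (continuous_leftTranslateWeight hθ.continuous _) (hasCompactSupport_leftTranslateWeight hθ.hasCompactSupport _) f
  have hF'eq : (smoothedVector W (leftTranslateWeight (n := 2) (archUnipotentAdelic K (s₀ • e)) θX) f :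
      (AdelicGroupData.gl 2 K).L2 μ) = ∫ g, F' s₀ g ∂(adelicHaar 2 K) :=
    coe_smoothedVector W (continuous_leftTranslateWeight hθXt.continuous _) (hasCompactSupport_leftTranslateWeight hθXt.hasCompactSupport _) f
  simp_rw [hFeq]
  rw [hF'eq]
  -- a compact set carrying all the derivative integrands for `s ∈ [s₀ - 1, s₀ + 1]`
  set D : Set (AdelicGroupData.gl 2 K).Adelic :=
    (fun p : ℝ × (AdelicGroupData.gl 2 K).Adelic => archUnipotentAdelic K (p.1 • e) * p.2) '' (Set.Icc (s₀ - 1) (s₀ + 1) ×ˢ tsupport θX)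
    with hD
  have hDc : IsCompact D := (isCompact_Icc.prod hθXt.hasCompactSupport).image
    ((continuous_archUnipotentAdelic.comp ((continuous_fst.smul continuous_const))).mul continuous_snd)
  obtain ⟨M, hM0, hM⟩ := hθXt.exists_forall_abs_le
  set bound : (AdelicGroupData.gl 2 K).Adelic → ℝ := fun g => D.indicator (fun _ => M * ‖(f : (AdelicGroupData.gl 2 K).L2 μ)‖) g with hbound
  have hbound_int : Integrable bound (adelicHaar 2 K) := by
    rw [hbound]
    exact (integrable_indicator_iff hDc.isClosed.measurableSet).2 (integrableOn_const (hDc.measure_lt_top.ne))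
  refine (hasDerivAt_integral_of_dominated_loc_of_deriv_le (μ := adelicHaar 2 K) (F := F) (F' := F') (x₀ := s₀)
    (s := Set.Ioo (s₀ - 1) (s₀ + 1)) (bound := bound) (Ioo_mem_nhds (by linarith) (by linarith)) ?_ ?_ ?_ ?_ hbound_int ?_).2
  · exact Filter.Eventually.of_forall fun s =>
      (integrable_ofReal_smul_rightRegular₂ (continuous_leftTranslateWeight hθ.continuous _)
        (hasCompactSupport_leftTranslateWeight hθ.hasCompactSupport _) _).aestronglyMeasurable
  · exact integrable_ofReal_smul_rightRegular₂ (continuous_leftTranslateWeight hθ.continuous _)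
      (hasCompactSupport_leftTranslateWeight hθ.hasCompactSupport _) _
  · exact (integrable_ofReal_smul_rightRegular₂ (continuous_leftTranslateWeight hθXt.continuous _)
      (hasCompactSupport_leftTranslateWeight hθXt.hasCompactSupport _) _).aestronglyMeasurable
  · refine ae_of_all _ fun g s hs => ?_
    rw [hF']
    simp only [leftTranslateWeight_apply]
    rw [_root_.norm_smul, Complex.norm_real, Real.norm_eq_abs]
    show _ ≤ D.indicator (fun _ => M * ‖(f : (AdelicGroupData.gl 2 K).L2 μ)‖) g
    by_cases hg : g ∈ D
    · rw [Set.indicator_of_mem hg]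
      exact mul_le_mul (hM _) (le_of_eq ((AdelicGroupData.gl 2 K).norm_rightRegular_apply μ g _)) (norm_nonneg _) hM0
    · -- off `D` the weight vanishes
      have hzero : θX ((archUnipotentAdelic K (s • e))⁻¹ * g) = 0 := by
        by_contra hne
        apply hg
        refine ⟨(s, (archUnipotentAdelic K (s • e))⁻¹ * g), ⟨Set.Ioo_subset_Icc_self hs, subset_tsupport _ hne⟩, ?_⟩
        simp only [mul_inv_cancel_left]
      rw [hzero, abs_zero, zero_mul]
      exact Set.indicator_nonneg (fun _ _ => mul_nonneg hM0 (norm_nonneg _)) g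
  · refine ae_of_all _ fun g s _ => ?_
    have h := (hasDerivAt_weight_archUnipotent_line hcpt hθ e g s).ofReal_comp.smul_const
      ((AdelicGroupData.gl 2 K).rightRegular μ g (f : (AdelicGroupData.gl 2 K).L2 μ))
    simpa only [hF, hF', leftTranslateWeight_apply] using h


/-! ### The fundamental theorem of calculus along the line -/

/-- `U_{se} S_η f = S_{L_{n(se)} η} f` for the unipotent line representation. [folklore] -/
theorem archUnipotentRep_smoothedVector {η : GL (Fin 2) (AdeleRing (𝓞 K) K) → ℝ} (hη : IsTestFunctionGL 2 K η)
    (f : W.toSubmodule) (x : mixedSpace K) :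
    archUnipotentRep μ (Multiplicative.ofAdd x) (smoothedVector W η f : (AdelicGroupData.gl 2 K).L2 μ) =
      (smoothedVector W (leftTranslateWeight (n := 2) (archUnipotentAdelic K x) η) f : (AdelicGroupData.gl 2 K).L2 μ) := by
  rw [archUnipotentRep_apply, coe_smoothedVector_leftTranslate W hη.continuous hη.hasCompactSupport]

/-- The orbit `s ↦ U_{se} S_η f` is continuous. [folklore] -/
theorem continuous_archUnipotentRep_line (v : (AdelicGroupData.gl 2 K).L2 μ) (e : mixedSpace K) :
    Continuous fun s : ℝ => archUnipotentRep μ (Multiplicative.ofAdd (s • e)) v := by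
  simp only [archUnipotentRep_apply]
  exact (continuous_rightRegular_archUnipotent μ v).comp (continuous_id.smul continuous_const)

/-- **FTC along the unipotent line**: `U_{te} S_θ f - S_θ f = ∫₀ᵗ U_{se} S_{θ_{X_e}} f ds` in `L²`.
[cite: Folland1995, Thm. 4.44] -/
theorem archUnipotentRep_sub_eq_intervalIntegral {θ : GL (Fin 2) (AdeleRing (𝓞 K) K) → ℝ}
    (hθ : IsTestFunctionGL 2 K θ) (e : mixedSpace K) (f : W.toSubmodule) (t : ℝ) :
    archUnipotentRep μ (Multiplicative.ofAdd (t • e)) (smoothedVector W θ f : (AdelicGroupData.gl 2 K).L2 μ) -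
        (smoothedVector W θ f : (AdelicGroupData.gl 2 K).L2 μ) =
      ∫ s in (0 : ℝ)..t, archUnipotentRep μ (Multiplicative.ofAdd (s • e))
        (smoothedVector W (derivWeight (AutomorphyDatum.gl 2 K hcpt).ofArch (unipotentLetter hcpt e) θ) f :
          (AdelicGroupData.gl 2 K).L2 μ) := by
  have hθXt : IsTestFunctionGL 2 K (derivWeight (AutomorphyDatum.gl 2 K hcpt).ofArch (unipotentLetter hcpt e) θ) :=
    isTestFunctionGL_derivWeight hcpt hθ _
  have h0 : (smoothedVector W θ f : (AdelicGroupData.gl 2 K).L2 μ) =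
      (smoothedVector W (leftTranslateWeight (n := 2) (archUnipotentAdelic K ((0 : ℝ) • e)) θ) f : (AdelicGroupData.gl 2 K).L2 μ) := by
    rw [zero_smul, archUnipotentAdelic_zero, leftTranslateWeight_one]
  rw [archUnipotentRep_smoothedVector W hθ, h0]
  simp_rw [archUnipotentRep_smoothedVector W hθXt]
  symm
  refine intervalIntegral.integral_eq_sub_of_hasDerivAt (fun s _ => hasDerivAt_smoothedVector_archUnipotent_line hcpt W hθ e f s) ?_
  refine Continuous.intervalIntegrable ?_ _ _
  have h := continuous_archUnipotentRep_line (μ := μ)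
    (smoothedVector W (derivWeight (AutomorphyDatum.gl 2 K hcpt).ofArch (unipotentLetter hcpt e) θ) f : (AdelicGroupData.gl 2 K).L2 μ) e
  simp_rw [archUnipotentRep_smoothedVector W hθXt] at h
  exact h

/-! ### Difference bounds of every order -/

omit [(AdelicGroupData.gl 2 K).IsAutomorphicMeasure μ] in
/-- The iterated difference as a power of the bounded operator `U_x - 1`. [folklore] -/
theorem iterDiff_eq_pow_apply (U : UnitaryRep (Multiplicative (mixedSpace K)) ((AdelicGroupData.gl 2 K).L2 μ)) (x : mixedSpace K) :
    ∀ (N : ℕ) (v : (AdelicGroupData.gl 2 K).L2 μ),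
      U.iterDiff x N v = (((U (Multiplicative.ofAdd x) : (AdelicGroupData.gl 2 K).L2 μ →L[ℂ] (AdelicGroupData.gl 2 K).L2 μ) - 1) ^ N) v
  | 0, v => by simp
  | N + 1, v => by
    rw [UnitaryRep.iterDiff_succ, iterDiff_eq_pow_apply U x N v, pow_succ']
    rfl

/-- **Difference bounds of every order**: `‖(U_{te} - 1)^N S_θ f‖ ≤ |t|^N ‖S_{θ_{X_e^N}} f‖` for a test
function `θ` (`θ_{X^N} = wordDerivWeight [X, …, X] θ`). [cite: JacquetShalikaAJM1981, §4] -/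
theorem norm_iterDiff_smoothedVector_le (e : mixedSpace K) (f : W.toSubmodule) (t : ℝ) :
    ∀ (N : ℕ) {θ : GL (Fin 2) (AdeleRing (𝓞 K) K) → ℝ}, IsTestFunctionGL 2 K θ →
      ‖(archUnipotentRep μ).iterDiff (t • e) N (smoothedVector W θ f : (AdelicGroupData.gl 2 K).L2 μ)‖ ≤
        |t| ^ N * ‖(smoothedVector W (wordDerivWeight (AutomorphyDatum.gl 2 K hcpt).ofArch
          (List.replicate N (unipotentLetter hcpt e)) θ) f : (AdelicGroupData.gl 2 K).L2 μ)‖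
  | 0, θ, _ => by rw [pow_zero, one_mul]; exact le_of_eq rfl
  | N + 1, θ, hθ => by
    set U := archUnipotentRep μ (K := K) with hU
    set θX := derivWeight (AutomorphyDatum.gl 2 K hcpt).ofArch (unipotentLetter hcpt e) θ with hθX
    have hθXt : IsTestFunctionGL 2 K θX := isTestFunctionGL_derivWeight hcpt hθ _
    set w : (AdelicGroupData.gl 2 K).L2 μ := (smoothedVector W θX f : (AdelicGroupData.gl 2 K).L2 μ) with hw
    -- `Δ^{N+1} S_θ f = Δ^N (U_{te} S_θ f - S_θ f) = Δ^N ∫₀ᵗ U_{se} w ds = ∫₀ᵗ U_{se} Δ^N w ds`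
    have hφc : Continuous fun s : ℝ => U (Multiplicative.ofAdd (s • e)) w := continuous_archUnipotentRep_line w e
    set P : (AdelicGroupData.gl 2 K).L2 μ →L[ℂ] (AdelicGroupData.gl 2 K).L2 μ :=
      ((U (Multiplicative.ofAdd (t • e)) : (AdelicGroupData.gl 2 K).L2 μ →L[ℂ] (AdelicGroupData.gl 2 K).L2 μ) - 1) ^ N with hP
    have hstep : U.iterDiff (t • e) (N + 1) (smoothedVector W θ f : (AdelicGroupData.gl 2 K).L2 μ) =
        ∫ s in (0 : ℝ)..t, U (Multiplicative.ofAdd (s • e)) (U.iterDiff (t • e) N w) := by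
      rw [UnitaryRep.iterDiff_succ', UnitaryRep.diff_apply, hU, archUnipotentRep_sub_eq_intervalIntegral hcpt W hθ e f t, ← hU, ← hw,
        iterDiff_eq_pow_apply, ← hP, ← P.intervalIntegral_comp_comm (hφc.intervalIntegrable _ _)]
      refine intervalIntegral.integral_congr fun s _ => ?_
      show P (U (Multiplicative.ofAdd (s • e)) w) = U (Multiplicative.ofAdd (s • e)) (U.iterDiff (t • e) N w)
      rw [hP, ← iterDiff_eq_pow_apply, UnitaryRep.iterDiff_map]
    rw [hstep]
    have hbd : ∀ s ∈ Ι (0 : ℝ) t, ‖U (Multiplicative.ofAdd (s • e)) (U.iterDiff (t • e) N w)‖ ≤ ‖U.iterDiff (t • e) N w‖ :=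
      fun s _ => (U.norm_map _ _).le
    calc ‖∫ s in (0 : ℝ)..t, U (Multiplicative.ofAdd (s • e)) (U.iterDiff (t • e) N w)‖
        ≤ ‖U.iterDiff (t • e) N w‖ * |t - 0| := intervalIntegral.norm_integral_le_of_norm_le_const hbd
      _ ≤ (|t| ^ N * ‖(smoothedVector W (wordDerivWeight (AutomorphyDatum.gl 2 K hcpt).ofArch
          (List.replicate N (unipotentLetter hcpt e)) θX) f : (AdelicGroupData.gl 2 K).L2 μ)‖) * |t - 0| :=
          mul_le_mul_of_nonneg_right (norm_iterDiff_smoothedVector_le e f t N hθXt) (abs_nonneg _)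
      _ = |t| ^ (N + 1) * ‖(smoothedVector W (wordDerivWeight (AutomorphyDatum.gl 2 K hcpt).ofArch
          (List.replicate (N + 1) (unipotentLetter hcpt e)) θ) f : (AdelicGroupData.gl 2 K).L2 μ)‖ := by
          rw [sub_zero, List.replicate_succ', wordDerivWeight_append_singleton hcpt, ← hθX, pow_succ]
          ring

end Literature.NumberTheory.Automorphic
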